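import Literature.NumberTheory.GelbartRogawski1991.DoubledUnitaryAdaptedBlocks
import Literature.NumberTheory.Automorphic.UnitaryGroupSymplecticEmbedding
import HarnessLib

/-!
# `Δ`-adapted block coordinates on `U(𝕍 ⊕ −𝕍)`, II: the hermitian form and the unitarity relations
# ([Kudla1994, §3]; [HarrisKudlaSweet1996, §1 (1.11)])

Topic `NumberTheory/GelbartRogawski1991`; namespace `Literature.NumberTheory.GelbartRogawski1991.AdaptedBlocks`
(sequel of `DoubledUnitaryAdaptedBlocks`).  KERNEL ONLY: proved lemmas over an arbitrary commutative ring `L` with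
`2` invertible and a ring endomorphism `σ` (the involution); no named fact, no `sorry`.

* §3 the hermitian form `h = hermForm σ (T ⊕ (−T))` of the doubled Gram matrix in the adapted frame:
  `h(dblV a + adblV b, dblV a' + adblV b') = 2 (aᴴ T b' + bᴴ T a')` — `Δ = {(u, u)}` and `Δ⁻ = {(u, −u)}` are
  totally isotropic and paired by `2T` (the anti-diagonal model `antidiag(2T, 2T)` of [HarrisKudlaSweet1996, (1.11)]);
* §4 the UNITARITY RELATIONS of `g ∈ U(σ, T ⊕ −T)` (`σ(g)ᵀ (T ⊕ −T) g = T ⊕ −T`) in the adapted blocks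
  `A, B, C, D` of `DoubledUnitaryAdaptedBlocks` (`Xᴴ := σ(X)ᵀ`):
  `Cᴴ T A + Aᴴ T C = 0`, `Cᴴ T B + Aᴴ T D = T`, `Dᴴ T A + Bᴴ T C = T`, `Dᴴ T B + Bᴴ T D = 0`
  (`rel₁₁`, `rel₁₂`, `rel₂₁`, `rel₂₂`; via `σ(adapt g)ᵀ · antidiag(2T, 2T) · adapt g = antidiag(2T, 2T)`).
  These are the identities behind Kudla's computation of the Leray cocycle on the big cell ([Kudla1994, §3]):
  `T · A C⁻¹` is skew-hermitian there, and `B − A C⁻¹ D = T⁻¹ C⁻ᴴ T`.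

Written for the kernel construction of [GelbartRogawski1991, Prop. 3.1.1] behind the cited input `hGRU` of the
Hodge-CM period-theorem package (stage-1 cell `pub-hodgecm`, seat GR-1, 2026-08-21); nothing here is a claim of the
manuscripts adjudicated by that cell.

## References

* S. S. Kudla, Israel J. Math. 87 (1994) 361–401, §3 [Kudla1994].
* M. Harris, S. S. Kudla, W. J. Sweet, J. Amer. Math. Soc. 9 (1996) 941–1004, §1 (1.11) [HarrisKudlaSweet1996].
-/

set_option autoImplicit false

open Matrix
open Literature.NumberTheory.Automorphic.UnitaryGroup

namespace Literature.NumberTheory.GelbartRogawski1991.AdaptedBlocks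

variable {L : Type*} [CommRing L] {ι : Type*}

/-! ## §3 The hermitian form of `T ⊕ (−T)` in the adapted frame -/

section Herm

variable [Fintype ι] (σ : L →+* L) (T : Matrix ι ι L)

/-- **`h(dblV a + adblV b, dblV a' + adblV b') = 2 (aᴴ T b' + bᴴ T a')`** for `h = hermForm σ (T ⊕ (−T))`: `Δ` and
`Δ⁻` are totally isotropic and `h` pairs them by `2T` (the anti-diagonal model `antidiag(2T, 2T)`).
[cite: HarrisKudlaSweet1996, §1 (1.11)] -/
theorem hermForm_dblV_adblV (a b a' b' : ι → L) :
    hermForm σ (Matrix.fromBlocks T 0 0 (-T)) (dblV a + adblV b) (dblV a' + adblV b') =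
      2 * ((⇑σ ∘ a) ⬝ᵥ (T *ᵥ b') + (⇑σ ∘ b) ⬝ᵥ (T *ᵥ a')) := by
  rw [hermForm_apply, dblV_add_adblV, dblV_add_adblV, Matrix.fromBlocks_mulVec, Sum.elim_comp_inl,
    Sum.elim_comp_inr, Sum.comp_elim, sumElim_dotProduct_sumElim, Matrix.zero_mulVec, Matrix.zero_mulVec,
    add_zero, zero_add, Matrix.neg_mulVec]
  have e1 : ⇑σ ∘ (a + b) = ⇑σ ∘ a + ⇑σ ∘ b := funext fun i => map_add σ (a i) (b i)
  have e2 : ⇑σ ∘ (a - b) = ⇑σ ∘ a - ⇑σ ∘ b := funext fun i => map_sub σ (a i) (b i)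
  rw [e1, e2]
  simp only [Matrix.mulVec_add, Matrix.mulVec_sub, dotProduct_add, add_dotProduct, dotProduct_sub, sub_dotProduct,
    dotProduct_neg]
  ring

/-- `h(dblV a, dblV a') = 0`: `Δ` is totally isotropic. [cite: HarrisKudlaSweet1996, §1 (1.11)] -/
theorem hermForm_dblV_dblV (a a' : ι → L) : hermForm σ (Matrix.fromBlocks T 0 0 (-T)) (dblV a) (dblV a') = 0 := by
  have h := hermForm_dblV_adblV σ T a 0 a' 0
  simp only [adblV_zero, add_zero, Matrix.mulVec_zero, dotProduct_zero, zero_add] at h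
  rw [h]
  have : (⇑σ ∘ (0 : ι → L)) = 0 := funext fun i => map_zero σ
  rw [this, zero_dotProduct, mul_zero]

/-- `h(dblV a, dblV a' + adblV b') = 2 aᴴ T b'`. [cite: HarrisKudlaSweet1996, §1 (1.11)] -/
theorem hermForm_dblV_left (a a' b' : ι → L) :
    hermForm σ (Matrix.fromBlocks T 0 0 (-T)) (dblV a) (dblV a' + adblV b') = 2 * ((⇑σ ∘ a) ⬝ᵥ (T *ᵥ b')) := by
  have h := hermForm_dblV_adblV σ T a 0 a' b'
  simp only [adblV_zero, add_zero] at h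
  rw [h]
  have : (⇑σ ∘ (0 : ι → L)) = 0 := funext fun i => map_zero σ
  rw [this, zero_dotProduct, add_zero]

end Herm

/-! ## §4 The unitarity relations in adapted blocks -/

section Unitary

variable [Fintype ι] [DecidableEq ι] [Invertible (2 : L)] (σ : L →+* L) (T : Matrix ι ι L)

omit [Fintype ι] [Invertible (2 : L)] in
/-- `σ(R)ᵀ = R`. [cite: HarrisKudlaSweet1996, §1 (1.11)] -/
private theorem cstar_cayR : ((cayR L ι).map σ)ᵀ = cayR L ι := by
  rw [cayR, Matrix.fromBlocks_map, Matrix.fromBlocks_transpose, Matrix.map_neg _ (map_neg σ),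
    Matrix.map_one σ (map_zero σ) (map_one σ), Matrix.transpose_neg, Matrix.transpose_one]

omit [Fintype ι] [DecidableEq ι] in
/-- `σ(⅟2) = ⅟2`. [cite: HarrisKudlaSweet1996, §1 (1.11)] -/
private theorem map_invOf_two : σ (⅟(2 : L)) = ⅟(2 : L) := by
  have h : (2 : L) * σ (⅟(2 : L)) = 1 :=
    calc (2 : L) * σ (⅟(2 : L)) = σ 2 * σ (⅟(2 : L)) := by rw [map_ofNat]
      _ = σ (2 * ⅟(2 : L)) := (map_mul σ _ _).symm
      _ = 1 := by rw [mul_invOf_self, map_one]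
  exact (invOf_eq_right_inv h).symm

omit [Fintype ι] in
/-- `σ(R⁻¹)ᵀ = R⁻¹`. [cite: HarrisKudlaSweet1996, §1 (1.11)] -/
private theorem cstar_cayRinv : ((cayRinv L ι).map σ)ᵀ = cayRinv L ι := by
  rw [cayRinv]
  have : ((⅟(2 : L) • cayR L ι).map σ) = ⅟(2 : L) • (cayR L ι).map σ := by
    ext i j
    simp only [Matrix.map_apply, Matrix.smul_apply, smul_eq_mul, map_mul, map_invOf_two]
  rw [this, Matrix.transpose_smul, cstar_cayR]

omit [Invertible (2 : L)] in
/-- `Rᵀ (T ⊕ −T) R = antidiag(2T, 2T)`. [cite: HarrisKudlaSweet1996, §1 (1.11)] -/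
private theorem cayR_mul_diag_mul_cayR :
    cayR L ι * Matrix.fromBlocks T 0 0 (-T) * cayR L ι = Matrix.fromBlocks 0 ((2 : L) • T) ((2 : L) • T) 0 := by
  rw [cayR, Matrix.fromBlocks_multiply, Matrix.fromBlocks_multiply, two_smul]
  simp only [Matrix.one_mul, Matrix.mul_one, Matrix.mul_zero, add_zero, zero_add, Matrix.mul_neg, Matrix.neg_mul,
    neg_neg]
  congr 1 <;> abel

variable {σ T}

/-- **the unitarity relations in the adapted frame**: if `σ(M)ᵀ (T ⊕ −T) M = T ⊕ −T` then
`σ(adapt M)ᵀ · antidiag(2T, 2T) · adapt M = antidiag(2T, 2T)`. [cite: HarrisKudlaSweet1996, §1 (1.11)] -/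
theorem cstar_adapt_mul_antidiag_mul_adapt {M : Matrix (ι ⊕ ι) (ι ⊕ ι) L}
    (hM : (M.map σ)ᵀ * Matrix.fromBlocks T 0 0 (-T) * M = Matrix.fromBlocks T 0 0 (-T)) :
    ((adapt M).map σ)ᵀ * Matrix.fromBlocks 0 ((2 : L) • T) ((2 : L) • T) 0 * adapt M =
      Matrix.fromBlocks 0 ((2 : L) • T) ((2 : L) • T) 0 := by
  have hst : ((adapt M).map σ)ᵀ = cayR L ι * (M.map σ)ᵀ * cayRinv L ι := by
    rw [adapt, Matrix.map_mul, Matrix.map_mul, Matrix.transpose_mul, Matrix.transpose_mul, cstar_cayR σ,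
      cstar_cayRinv σ, Matrix.mul_assoc]
  rw [hst, ← cayR_mul_diag_mul_cayR, adapt]
  calc cayR L ι * (M.map σ)ᵀ * cayRinv L ι * (cayR L ι * Matrix.fromBlocks T 0 0 (-T) * cayR L ι) *
        (cayRinv L ι * M * cayR L ι)
      = cayR L ι * (M.map σ)ᵀ * (cayRinv L ι * cayR L ι) * Matrix.fromBlocks T 0 0 (-T) *
          (cayR L ι * cayRinv L ι) * M * cayR L ι := by simp only [Matrix.mul_assoc]
    _ = cayR L ι * ((M.map σ)ᵀ * Matrix.fromBlocks T 0 0 (-T) * M) * cayR L ι := by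
          rw [cayRinv_mul_cayR, cayR_mul_cayRinv, Matrix.mul_one, Matrix.mul_one]; simp only [Matrix.mul_assoc]
    _ = cayR L ι * Matrix.fromBlocks T 0 0 (-T) * cayR L ι := by rw [hM, Matrix.mul_assoc]

omit [DecidableEq ι] [Invertible (2 : L)] in
/-- `X (2T) Y = 2 (X T Y)`. [cite: HarrisKudlaSweet1996, §1 (1.11)] -/
private theorem mul_two_smul_mul (X Y : Matrix ι ι L) : X * ((2 : L) • T) * Y = (2 : L) • (X * T * Y) := by
  rw [Matrix.mul_smul, Matrix.smul_mul]

omit [Fintype ι] [DecidableEq ι] in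
/-- halving: `2 • X = 2 • Y → X = Y`. [cite: HarrisKudlaSweet1996, §1 (1.11)] -/
private theorem eq_of_two_smul_eq {X Y : Matrix ι ι L} (h : (2 : L) • X = (2 : L) • Y) : X = Y := by
  have := congrArg (fun Z : Matrix ι ι L => ⅟(2 : L) • Z) h
  simpa only [smul_smul, invOf_mul_self, one_smul] using this

/-- **THE FOUR UNITARITY RELATIONS** of `g ∈ U(σ, T ⊕ −T)` in adapted blocks (`Xᴴ = σ(X)ᵀ`):
`Cᴴ T A + Aᴴ T C = 0`, `Cᴴ T B + Aᴴ T D = T`, `Dᴴ T A + Bᴴ T C = T`, `Dᴴ T B + Bᴴ T D = 0`.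
[cite: HarrisKudlaSweet1996, §1 (1.11); Kudla1994, §3] -/
theorem rels {M : Matrix (ι ⊕ ι) (ι ⊕ ι) L}
    (hM : (M.map σ)ᵀ * Matrix.fromBlocks T 0 0 (-T) * M = Matrix.fromBlocks T 0 0 (-T)) :
    ((blkC M).map σ)ᵀ * T * blkA M + ((blkA M).map σ)ᵀ * T * blkC M = 0 ∧
      ((blkC M).map σ)ᵀ * T * blkB M + ((blkA M).map σ)ᵀ * T * blkD M = T ∧
        ((blkD M).map σ)ᵀ * T * blkA M + ((blkB M).map σ)ᵀ * T * blkC M = T ∧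
          ((blkD M).map σ)ᵀ * T * blkB M + ((blkB M).map σ)ᵀ * T * blkD M = 0 := by
  have h := cstar_adapt_mul_antidiag_mul_adapt hM
  rw [adapt_eq, Matrix.fromBlocks_map, Matrix.fromBlocks_transpose, Matrix.fromBlocks_multiply,
    Matrix.fromBlocks_multiply] at h
  simp only [Matrix.mul_zero, zero_add, add_zero, mul_two_smul_mul, ← smul_add] at h
  obtain ⟨h₁, h₂, h₃, h₄⟩ := Matrix.fromBlocks_inj.1 h
  refine ⟨?_, ?_, ?_, ?_⟩
  · apply eq_of_two_smul_eq; rw [h₁, smul_zero]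
  · exact eq_of_two_smul_eq h₂
  · exact eq_of_two_smul_eq h₃
  · apply eq_of_two_smul_eq; rw [h₄, smul_zero]

/-- `Cᴴ T A + Aᴴ T C = 0` (`T · A C⁻¹` is skew-hermitian on the big cell). [cite: Kudla1994, §3] -/
theorem rel₁₁ {M : Matrix (ι ⊕ ι) (ι ⊕ ι) L}
    (hM : (M.map σ)ᵀ * Matrix.fromBlocks T 0 0 (-T) * M = Matrix.fromBlocks T 0 0 (-T)) :
    ((blkC M).map σ)ᵀ * T * blkA M + ((blkA M).map σ)ᵀ * T * blkC M = 0 :=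
  (rels hM).1

/-- `Cᴴ T B + Aᴴ T D = T`. [cite: Kudla1994, §3] -/
theorem rel₁₂ {M : Matrix (ι ⊕ ι) (ι ⊕ ι) L}
    (hM : (M.map σ)ᵀ * Matrix.fromBlocks T 0 0 (-T) * M = Matrix.fromBlocks T 0 0 (-T)) :
    ((blkC M).map σ)ᵀ * T * blkB M + ((blkA M).map σ)ᵀ * T * blkD M = T :=
  (rels hM).2.1

/-- `Dᴴ T A + Bᴴ T C = T`. [cite: Kudla1994, §3] -/
theorem rel₂₁ {M : Matrix (ι ⊕ ι) (ι ⊕ ι) L}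
    (hM : (M.map σ)ᵀ * Matrix.fromBlocks T 0 0 (-T) * M = Matrix.fromBlocks T 0 0 (-T)) :
    ((blkD M).map σ)ᵀ * T * blkA M + ((blkB M).map σ)ᵀ * T * blkC M = T :=
  (rels hM).2.2.1

/-- `Dᴴ T B + Bᴴ T D = 0`. [cite: Kudla1994, §3] -/
theorem rel₂₂ {M : Matrix (ι ⊕ ι) (ι ⊕ ι) L}
    (hM : (M.map σ)ᵀ * Matrix.fromBlocks T 0 0 (-T) * M = Matrix.fromBlocks T 0 0 (-T)) :
    ((blkD M).map σ)ᵀ * T * blkB M + ((blkB M).map σ)ᵀ * T * blkD M = 0 :=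
  (rels hM).2.2.2

/-! ### The converse direction and the relations for the inverse -/

/-- `R · adapt M · R⁻¹ = M`. [cite: HarrisKudlaSweet1996, §1 (1.11)] -/
theorem cayR_mul_adapt_mul_cayRinv (M : Matrix (ι ⊕ ι) (ι ⊕ ι) L) : cayR L ι * adapt M * cayRinv L ι = M := by
  rw [adapt, ← Matrix.mul_assoc, ← Matrix.mul_assoc, cayR_mul_cayRinv, Matrix.one_mul, Matrix.mul_assoc,
    cayR_mul_cayRinv, Matrix.mul_one]

/-- `adapt (R Y R⁻¹) = Y`: the matrix with PRESCRIBED adapted blocks `Y`. [cite: HarrisKudlaSweet1996, §1 (1.11)] -/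
theorem adapt_conj (Y : Matrix (ι ⊕ ι) (ι ⊕ ι) L) : adapt (cayR L ι * Y * cayRinv L ι) = Y := by
  rw [adapt, ← Matrix.mul_assoc, ← Matrix.mul_assoc, cayRinv_mul_cayR, Matrix.one_mul, Matrix.mul_assoc,
    cayRinv_mul_cayR, Matrix.mul_one]

/-- **the converse, conjugation form**: if `Y` preserves `antidiag(2T, 2T)` then `R Y R⁻¹` preserves `T ⊕ −T` —
elements of `U(σ, T ⊕ −T)` with PRESCRIBED adapted blocks. [cite: HarrisKudlaSweet1996, §1 (1.11)] -/
theorem cstar_mul_diag_mul_of_conj {Y : Matrix (ι ⊕ ι) (ι ⊕ ι) L}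
    (hY : (Y.map σ)ᵀ * Matrix.fromBlocks 0 ((2 : L) • T) ((2 : L) • T) 0 * Y =
      Matrix.fromBlocks 0 ((2 : L) • T) ((2 : L) • T) 0) :
    ((cayR L ι * Y * cayRinv L ι).map σ)ᵀ * Matrix.fromBlocks T 0 0 (-T) * (cayR L ι * Y * cayRinv L ι) =
      Matrix.fromBlocks T 0 0 (-T) := by
  have hst : ((cayR L ι * Y * cayRinv L ι).map σ)ᵀ = cayRinv L ι * (Y.map σ)ᵀ * cayR L ι := by
    rw [Matrix.map_mul, Matrix.map_mul, Matrix.transpose_mul, Matrix.transpose_mul, cstar_cayR σ,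
      cstar_cayRinv σ, Matrix.mul_assoc]
  have hJ : Matrix.fromBlocks T 0 0 (-T) =
      cayRinv L ι * Matrix.fromBlocks 0 ((2 : L) • T) ((2 : L) • T) 0 * cayRinv L ι := by
    rw [← cayR_mul_diag_mul_cayR, ← Matrix.mul_assoc, ← Matrix.mul_assoc, cayRinv_mul_cayR, Matrix.one_mul,
      Matrix.mul_assoc, cayR_mul_cayRinv, Matrix.mul_one]
  rw [hst, hJ]
  calc cayRinv L ι * (Y.map σ)ᵀ * cayR L ι *
        (cayRinv L ι * Matrix.fromBlocks 0 ((2 : L) • T) ((2 : L) • T) 0 * cayRinv L ι) *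
        (cayR L ι * Y * cayRinv L ι)
      = cayRinv L ι * (Y.map σ)ᵀ * (cayR L ι * cayRinv L ι) *
          Matrix.fromBlocks 0 ((2 : L) • T) ((2 : L) • T) 0 * (cayRinv L ι * cayR L ι) * Y * cayRinv L ι := by
          simp only [Matrix.mul_assoc]
    _ = cayRinv L ι * ((Y.map σ)ᵀ * Matrix.fromBlocks 0 ((2 : L) • T) ((2 : L) • T) 0 * Y) * cayRinv L ι := by
          rw [cayRinv_mul_cayR, cayR_mul_cayRinv, Matrix.mul_one, Matrix.mul_one]; simp only [Matrix.mul_assoc]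
    _ = cayRinv L ι * Matrix.fromBlocks 0 ((2 : L) • T) ((2 : L) • T) 0 * cayRinv L ι := by rw [hY]

/-- **the converse**: a matrix whose adapted form preserves `antidiag(2T, 2T)` preserves `T ⊕ −T` — membership in
`U(σ, T ⊕ −T)` can be checked in the adapted frame. [cite: HarrisKudlaSweet1996, §1 (1.11)] -/
theorem cstar_mul_diag_mul_of_adapt {M : Matrix (ι ⊕ ι) (ι ⊕ ι) L}
    (hA : ((adapt M).map σ)ᵀ * Matrix.fromBlocks 0 ((2 : L) • T) ((2 : L) • T) 0 * adapt M =
      Matrix.fromBlocks 0 ((2 : L) • T) ((2 : L) • T) 0) :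
    (M.map σ)ᵀ * Matrix.fromBlocks T 0 0 (-T) * M = Matrix.fromBlocks T 0 0 (-T) := by
  have h := cstar_mul_diag_mul_of_conj hA
  rwa [cayR_mul_adapt_mul_cayRinv] at h

omit [Invertible (2 : L)] in
/-- the inverse relation `M (T ⊕ −T)⁻¹ Mᴴ = (T ⊕ −T)⁻¹` for `M ∈ U(σ, T ⊕ −T)` with `det M`, `det T` units
(`(T ⊕ −T)⁻¹ = T⁻¹ ⊕ −T⁻¹`). [cite: HarrisKudlaSweet1996, §1 (1.11)] -/
theorem mul_diagInv_mul_cstar {M : Matrix (ι ⊕ ι) (ι ⊕ ι) L} (hT : IsUnit T.det) (hMu : IsUnit M.det)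
    (hM : (M.map σ)ᵀ * Matrix.fromBlocks T 0 0 (-T) * M = Matrix.fromBlocks T 0 0 (-T)) :
    M * Matrix.fromBlocks T⁻¹ 0 0 (-T⁻¹) * (M.map σ)ᵀ = Matrix.fromBlocks T⁻¹ 0 0 (-T⁻¹) := by
  set J : Matrix (ι ⊕ ι) (ι ⊕ ι) L := Matrix.fromBlocks T 0 0 (-T) with hJdef
  set J' : Matrix (ι ⊕ ι) (ι ⊕ ι) L := Matrix.fromBlocks T⁻¹ 0 0 (-T⁻¹) with hJ'def
  have hJJ' : J * J' = 1 := by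
    rw [hJdef, hJ'def, Matrix.fromBlocks_multiply, ← Matrix.fromBlocks_one]
    simp [Matrix.mul_nonsing_inv T hT]
  have hJ'J : J' * J = 1 := by
    rw [hJdef, hJ'def, Matrix.fromBlocks_multiply, ← Matrix.fromBlocks_one]
    simp [Matrix.nonsing_inv_mul T hT]
  have key : M * J' * (M.map σ)ᵀ * (J * M) = M := by
    calc M * J' * (M.map σ)ᵀ * (J * M) = M * J' * ((M.map σ)ᵀ * J * M) := by simp only [Matrix.mul_assoc]
      _ = M := by rw [hM, Matrix.mul_assoc, hJ'J, Matrix.mul_one]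
  have hMM : M * M⁻¹ = 1 := Matrix.mul_nonsing_inv M hMu
  calc M * J' * (M.map σ)ᵀ = M * J' * (M.map σ)ᵀ * (J * M) * (M⁻¹ * J') := by
        rw [Matrix.mul_assoc (M * J' * (M.map σ)ᵀ), Matrix.mul_assoc J, ← Matrix.mul_assoc M M⁻¹, hMM,
          Matrix.one_mul, hJJ', Matrix.mul_one]
    _ = J' := by rw [key, ← Matrix.mul_assoc, hMM, Matrix.one_mul]

omit [Invertible (2 : L)] in
/-- `R (T⁻¹ ⊕ −T⁻¹) R = antidiag(2T⁻¹, 2T⁻¹)`. [cite: HarrisKudlaSweet1996, §1 (1.11)] -/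
private theorem cayR_mul_diagInv_mul_cayR :
    cayR L ι * Matrix.fromBlocks T⁻¹ 0 0 (-T⁻¹) * cayR L ι = Matrix.fromBlocks 0 ((2 : L) • T⁻¹) ((2 : L) • T⁻¹) 0 :=
  cayR_mul_diag_mul_cayR T⁻¹

/-- the inverse relation in the adapted frame: `adapt M · antidiag(½T⁻¹, ½T⁻¹) · (adapt M)ᴴ = antidiag(½T⁻¹, ½T⁻¹)`.
[cite: HarrisKudlaSweet1996, §1 (1.11)] -/
theorem adapt_mul_antidiagInv_mul_cstar {M : Matrix (ι ⊕ ι) (ι ⊕ ι) L} (hT : IsUnit T.det) (hMu : IsUnit M.det)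
    (hM : (M.map σ)ᵀ * Matrix.fromBlocks T 0 0 (-T) * M = Matrix.fromBlocks T 0 0 (-T)) :
    adapt M * Matrix.fromBlocks 0 (⅟(2 : L) • T⁻¹) (⅟(2 : L) • T⁻¹) 0 * ((adapt M).map σ)ᵀ =
      Matrix.fromBlocks 0 (⅟(2 : L) • T⁻¹) (⅟(2 : L) • T⁻¹) 0 := by
  have h := mul_diagInv_mul_cstar hT hMu hM
  have hst : ((adapt M).map σ)ᵀ = cayR L ι * (M.map σ)ᵀ * cayRinv L ι := by
    rw [adapt, Matrix.map_mul, Matrix.map_mul, Matrix.transpose_mul, Matrix.transpose_mul, cstar_cayR σ,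
      cstar_cayRinv σ, Matrix.mul_assoc]
  -- `antidiag(½T⁻¹, ½T⁻¹) = R⁻¹ (T⁻¹ ⊕ −T⁻¹) R⁻¹`
  have hJ : Matrix.fromBlocks 0 (⅟(2 : L) • T⁻¹) (⅟(2 : L) • T⁻¹) 0 =
      cayRinv L ι * Matrix.fromBlocks T⁻¹ 0 0 (-T⁻¹) * cayRinv L ι := by
    rw [cayRinv, Matrix.smul_mul, Matrix.smul_mul, Matrix.mul_smul, cayR_mul_diagInv_mul_cayR, smul_smul,
      Matrix.fromBlocks_smul, smul_zero, smul_smul,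
      show ⅟(2 : L) * ⅟(2 : L) * 2 = ⅟(2 : L) by rw [mul_assoc, invOf_mul_self, mul_one]]
  rw [hJ, hst, adapt]
  calc cayRinv L ι * M * cayR L ι * (cayRinv L ι * Matrix.fromBlocks T⁻¹ 0 0 (-T⁻¹) * cayRinv L ι) *
        (cayR L ι * (M.map σ)ᵀ * cayRinv L ι)
      = cayRinv L ι * M * (cayR L ι * cayRinv L ι) * Matrix.fromBlocks T⁻¹ 0 0 (-T⁻¹) *
          (cayRinv L ι * cayR L ι) * (M.map σ)ᵀ * cayRinv L ι := by simp only [Matrix.mul_assoc]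
    _ = cayRinv L ι * (M * Matrix.fromBlocks T⁻¹ 0 0 (-T⁻¹) * (M.map σ)ᵀ) * cayRinv L ι := by
          rw [cayR_mul_cayRinv, cayRinv_mul_cayR, Matrix.mul_one, Matrix.mul_one]; simp only [Matrix.mul_assoc]
    _ = cayRinv L ι * Matrix.fromBlocks T⁻¹ 0 0 (-T⁻¹) * cayRinv L ι := by rw [h]

omit [DecidableEq ι] in
/-- `X (½S) Y = ½ (X S Y)`. [cite: HarrisKudlaSweet1996, §1 (1.11)] -/
private theorem mul_half_smul_mul (S X Y : Matrix ι ι L) : X * (⅟(2 : L) • S) * Y = ⅟(2 : L) • (X * S * Y) := by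
  rw [Matrix.mul_smul, Matrix.smul_mul]

omit [Fintype ι] [DecidableEq ι] in
/-- doubling: `½ • X = ½ • Y → X = Y`. [cite: HarrisKudlaSweet1996, §1 (1.11)] -/
private theorem eq_of_half_smul_eq {X Y : Matrix ι ι L} (h : ⅟(2 : L) • X = ⅟(2 : L) • Y) : X = Y := by
  have := congrArg (fun Z : Matrix ι ι L => (2 : L) • Z) h
  simpa only [smul_smul, mul_invOf_self, one_smul] using this

/-- **THE FOUR RELATIONS FOR THE INVERSE** of `g ∈ U(σ, T ⊕ −T)` (`det g`, `det T` units) in adapted blocks: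
`B T⁻¹ Aᴴ + A T⁻¹ Bᴴ = 0`, `B T⁻¹ Cᴴ + A T⁻¹ Dᴴ = T⁻¹`, `D T⁻¹ Aᴴ + C T⁻¹ Bᴴ = T⁻¹`, `D T⁻¹ Cᴴ + C T⁻¹ Dᴴ = 0`
(the adapted blocks of `g⁻¹` are `T⁻¹Dᴴ T, T⁻¹BᴴT, T⁻¹CᴴT, T⁻¹AᴴT`). [cite: HarrisKudlaSweet1996, §1 (1.11); Kudla1994, §3] -/
theorem rels_inv {M : Matrix (ι ⊕ ι) (ι ⊕ ι) L} (hT : IsUnit T.det) (hMu : IsUnit M.det)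
    (hM : (M.map σ)ᵀ * Matrix.fromBlocks T 0 0 (-T) * M = Matrix.fromBlocks T 0 0 (-T)) :
    blkB M * T⁻¹ * ((blkA M).map σ)ᵀ + blkA M * T⁻¹ * ((blkB M).map σ)ᵀ = 0 ∧
      blkB M * T⁻¹ * ((blkC M).map σ)ᵀ + blkA M * T⁻¹ * ((blkD M).map σ)ᵀ = T⁻¹ ∧
        blkD M * T⁻¹ * ((blkA M).map σ)ᵀ + blkC M * T⁻¹ * ((blkB M).map σ)ᵀ = T⁻¹ ∧
          blkD M * T⁻¹ * ((blkC M).map σ)ᵀ + blkC M * T⁻¹ * ((blkD M).map σ)ᵀ = 0 := by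
  have h := adapt_mul_antidiagInv_mul_cstar hT hMu hM
  rw [adapt_eq, Matrix.fromBlocks_map, Matrix.fromBlocks_transpose, Matrix.fromBlocks_multiply,
    Matrix.fromBlocks_multiply] at h
  simp only [Matrix.mul_zero, zero_add, add_zero, mul_half_smul_mul, ← smul_add] at h
  obtain ⟨h₁, h₂, h₃, h₄⟩ := Matrix.fromBlocks_inj.1 h
  refine ⟨?_, ?_, ?_, ?_⟩
  · apply eq_of_half_smul_eq; rw [h₁, smul_zero]
  · exact eq_of_half_smul_eq h₂
  · exact eq_of_half_smul_eq h₃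
  · apply eq_of_half_smul_eq; rw [h₄, smul_zero]

/-- `D T⁻¹ Cᴴ + C T⁻¹ Dᴴ = 0` (on the big cell, `T · C⁻¹ D` is skew-hermitian). [cite: Kudla1994, §3] -/
theorem rel_inv₂₂ {M : Matrix (ι ⊕ ι) (ι ⊕ ι) L} (hT : IsUnit T.det) (hMu : IsUnit M.det)
    (hM : (M.map σ)ᵀ * Matrix.fromBlocks T 0 0 (-T) * M = Matrix.fromBlocks T 0 0 (-T)) :
    blkD M * T⁻¹ * ((blkC M).map σ)ᵀ + blkC M * T⁻¹ * ((blkD M).map σ)ᵀ = 0 :=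
  (rels_inv hT hMu hM).2.2.2

/-- `B T⁻¹ Aᴴ + A T⁻¹ Bᴴ = 0` (on `P_Δ`, `B T⁻¹ Aᴴ` is skew-hermitian). [cite: Kudla1994, §3] -/
theorem rel_inv₁₁ {M : Matrix (ι ⊕ ι) (ι ⊕ ι) L} (hT : IsUnit T.det) (hMu : IsUnit M.det)
    (hM : (M.map σ)ᵀ * Matrix.fromBlocks T 0 0 (-T) * M = Matrix.fromBlocks T 0 0 (-T)) :
    blkB M * T⁻¹ * ((blkA M).map σ)ᵀ + blkA M * T⁻¹ * ((blkB M).map σ)ᵀ = 0 :=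
  (rels_inv hT hMu hM).1

end Unitary

end Literature.NumberTheory.GelbartRogawski1991.AdaptedBlocks
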